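import Mathlib
import HarnessLib
import Summits.Langlands.Statement
import Literature.NumberTheory.Automorphic.GaloisActionPlaces
import Literature.NumberTheory.Automorphic.AsaiSign
import Literature.NumberTheory.Automorphic.UnitaryGroupAutomorphicRep

/-!
# Sketch — first lemmas of the crux idea cards for `QuadraticWindow.HostInducedRep`
(planner crux-ideate, ideator 3, round 1; gen 2 adds §3). Statements only (`Prop`s); nothing is
proved here.

* §1 `SignPinConstancy` — card `flicker-period-sign-pin` (gen 1).
* §2 `GenericDescent` — card `grs-generic-descent` (gen 1).
* §3 `InfinityType.IsWeaklyRegular`, `FPWeaklyRegularOddCM` — card `weakly-regular-odd-host`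
  (gen 2): the candidate NAMED FACT "Fakhruddin–Pilloni 2021, Thm. 9.10" in its CM /
  conjugate-self-dual form, typed over the tree's `AsaiSign` vocabulary (F–P oddness of a
  conjugate self-dual `Π` on `GL_N/K` = the tree's `HasAsaiSign c 1`, i.e. the pole is at
  `As^{(-1)^{N-1}}`).
-/

namespace Summit.Langlands.Langlands.Cruxes.HostInducedRep.Sketch

open scoped BigOperators Classical
open Filter Set Function
open Literature.NumberTheory.Automorphic Literature.NumberTheory.GaloisRepresentations

/-! ## §1 (gen 1) -/

/-- Card `flicker-period-sign-pin`, first lemma (SIGN PIN / constancy at the complex-type real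
places). For a τ-polarized (a.e., w.r.t. the Artin avatar `e` and norm exponent `k`, exactly the
clause of `QuadraticWindow.HostInducedRep`) regular algebraic cuspidal `π` on `GL_n/F`, `F/F₀`
quadratic over totally real `F₀` with involution `τ`: the sign `det e(c_v) = η_v(-1)` is the SAME at
all real places `v` of `F₀` that do not lie under a real place of `F` (i.e. `F_w = ℂ` above `v`).
Informal value: `det e(c_v) = s · (-1)^{n-1}` with `s` the `F/F₀`-Asai sign of `(π, η)`.
gen-2 remark: for ODD `n` this is a three-line consequence of central characters
(`ω_π ω_π^τ = η^n ∘ N`, so `ω_π|_{𝔸_{F₀}^×} = η^n · μ`, `μ ∈ {1, ω_{F/F₀}}`, and at a complex-type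
`v`, `ω_{π,w}(-1) = (-1)^{a+b}` is constant); for EVEN `n` it is the open point. -/
def SignPinConstancy : Prop :=
  ∀ (F₀ F : Type) [Field F₀] [NumberField F₀] [Field F] [NumberField F] [Algebra F₀ F]
    (τ : F ≃ₐ[F₀] F), NumberField.IsTotallyReal F₀ → Module.finrank F₀ F = 2 → τ ≠ 1 →
    ∀ (n : ℕ) (hcpt : isCompact_glFiniteIntegralLevel n F) (π : CuspidalAutomorphicRepData n F hcpt)
      (e : FramedGaloisRep F₀ ℂ 1) (k : ℤ), 0 < n → π.1.IsRegularAlgebraic →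
      (∀ᶠ w in Filter.cofinite, ∀ (α β : Multiset ℂ) (c : ℂ), π.1.HasSatakeParamAt w α →
        π.1.HasSatakeParamAt (τ • w) β →
        e.HasFrobCharpolyAt (w.under (NumberField.RingOfIntegers F₀)) (Polynomial.X - Polynomial.C c) →
        β = α.map (fun a ↦ a⁻¹ * (c * ((w.under (NumberField.RingOfIntegers F₀)).residueCard : ℂ) ^ k) ^
          w.asIdeal.inertiaDeg (NumberField.RingOfIntegers F₀))) →
      ∀ (φ₀ φ₀' : F₀ →+* ℝ) (c c' : Field.absoluteGaloisGroup F₀),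
        IsComplexConjugation φ₀ c → IsComplexConjugation φ₀' c' →
        (∀ φ : F →+* ℝ, φ.comp (algebraMap F₀ F) ≠ φ₀) →
        (∀ φ : F →+* ℝ, φ.comp (algebraMap F₀ F) ≠ φ₀') →
        Matrix.GeneralLinearGroup.det (e c) = Matrix.GeneralLinearGroup.det (e c')

/-! ## §2 (gen 1) -/

/-- Card `grs-generic-descent`, first lemma (trace-formula-free descent to the quasi-split unitary
group, Ginzburg–Rallis–Soudry): a conjugate self-dual (a.e.) cuspidal `Π` on `GL_N/K`, `K/F₀`
quadratic with involution `c`, whose Asai sign is the standard one (`HasAsaiSign c 1`, i.e. the pole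
is at `As^{(-1)^{N-1}}`) is a weak base change of a cuspidal automorphic representation of Mok's
quasi-split `U_{K/F₀}(N)` (informally: of a globally GENERIC one, unramified wherever `Π` and `K/F₀`
are, whose archimedean components are the generic members of their `L`-packets). -/
def GenericDescent : Prop :=
  ∀ (F₀ K : Type) [Field F₀] [NumberField F₀] [Field K] [NumberField K] [Algebra F₀ K]
    (c : K ≃ₐ[F₀] K), Module.finrank F₀ K = 2 → c ≠ 1 →
    ∀ (N : ℕ) (hcpt : isCompact_glFiniteIntegralLevel N K) (P : CuspidalAutomorphicRepData N K hcpt),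
      0 < N → P.1.IsConjSelfDualAE c → P.1.HasAsaiSign c 1 →
      ∃ σ : UnitaryGroup.CuspidalAutomorphicRepData F₀ K c N hcpt,
        UnitaryGroup.IsWeakBaseChange F₀ K c N hcpt P.1 σ.1

/-! ## §3 (gen 2): the Fakhruddin–Pilloni interface -/

/-- **Weakly regular infinity type** (Fakhruddin–Pilloni 2021, §9.1: "we allow the weights of the
infinitesimal character to repeat at most twice"): at every embedding every `z`-exponent `a` occurs
with multiplicity `≤ 2` in the type. (For the induced type of a regular algebraic `π` along a
quadratic `F/F₀`, and for its base change to a CM `K ⊃ F₀`, the multiplicity is EXACTLY `2` —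
Clozel–Raghuram purity; `InfinityType.automorphicInduction`.) -/
def _root_.Literature.NumberTheory.Automorphic.InfinityType.IsWeaklyRegular
    {K : Type*} [Field K] {n : ℕ} (T : InfinityType K n) : Prop :=
  ∀ (σ : K →+* ℂ) (a : ℂ), ((T σ).map ArchWeight.a).count a ≤ 2

/-- **Candidate named fact `FakhruddinPilloni2021`, Thm. 9.10 — CM / conjugate-self-dual form**
(card `weakly-regular-odd-host`). `K` a CM field, quadratic over the totally real `F₀` with
conjugation `c`; `Π` a cuspidal automorphic representation of `GL_N(𝔸_K)` which is C-algebraic and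
WEAKLY REGULAR (`IsWeaklyRegular`), conjugate self-dual a.e. (`IsConjSelfDualAE c`) and ODD in the
sense of F–P §9.1 — for conjugate self-dual `Π` (their `χ = 1`, `χ₀ = 1`, `ε(χ₀) = 1`) oddness is
"`L(s, As^{(-1)^{N-1}}(Π))` has a pole at `s = 1`", i.e. the tree's `HasAsaiSign c 1`. Then for
every `ℓ`, `ι` there is a semisimple `r : Γ_K → GL_N(ℚ̄_ℓ)` which at EVERY finite `v ∤ ℓ` where `Π`
has a Satake parameter `α` is unramified with arithmetic-Frobenius characteristic polynomial
`∏_j (X - ι⁻¹((q_v^{(N-1)/2} α_j)⁻¹))` (F–P 9.10 (2): `WD(r|_{Γ_{K_v}})^{F-ss} = rec(Π_v ⊗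
|det|^{(1-N)/2})`, same normalisation as the tree's `exists_galoisRep_of_regularAlgebraic`).
Printed proof: Mok's descent to the quasi-split `U(N)` in non-degenerate limit-of-discrete-series
weight (F–P Thm. 9.6, conditional on Mok 2014 / TWFL), realisation in the interior coherent
cohomology of the PEL Shimura variety of `G ⊂ Res GU` with rational similitude, and "the Hecke
eigensystem of `π̃` is a `p`-adic limit of Hecke eigensystems of regular ones" (Pilloni–Stroh 2016 /
Goldring–Koskivirta 2019; Boxer–Pilloni 2021 Thm. 6.11 re-proves it by higher Coleman theory and
adds compatibility at `p`). -/
def FPWeaklyRegularOddCM : Prop :=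
  ∀ (F₀ K : Type) [Field F₀] [NumberField F₀] [Field K] [NumberField K] [Algebra F₀ K]
    (c : K ≃ₐ[F₀] K), NumberField.IsTotallyReal F₀ → NumberField.IsCMField K →
    Module.finrank F₀ K = 2 → c ≠ 1 →
    ∀ (N : ℕ) (hcpt : isCompact_glFiniteIntegralLevel N K) (P : CuspidalAutomorphicRepData N K hcpt),
      0 < N →
      (∃ T : InfinityType K N, P.1.HasInfinityType T ∧ T.IsCAlgebraic ∧ T.IsWeaklyRegular) →
      P.1.IsConjSelfDualAE c → P.1.HasAsaiSign c 1 →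
      ∀ (ℓ : ℕ) [Fact ℓ.Prime] (ι : PadicAlgCl ℓ ≃+* ℂ),
        ∃ r : FramedGaloisRep K (PadicAlgCl ℓ) N, r.toGaloisRep.IsSemisimple ∧
          ∀ (v : IsDedekindDomain.HeightOneSpectrum (NumberField.RingOfIntegers K)) (α : Multiset ℂ),
            P.1.HasSatakeParamAt v α → ((ℓ : ℕ) : NumberField.RingOfIntegers K) ∉ v.asIdeal →
              r.IsUnramifiedAt v ∧ r.HasFrobCharpolyAt v (arithFrobPolyOfSatake ι v.residueCard N α)

end Summit.Langlands.Langlands.Cruxes.HostInducedRep.Sketch
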